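import Summits.QuantumFields.YangMills.Theorems.BalabanUVNodesN19InEdgesAtRecord

/-!
# YM-DAG node N19 — IN-EDGE N16 → N19 IN THE η-NORMALISED C¹ CURRENCY: the unit table of the analyticity chart and the liaison twin
# `ne3LiaisonC1_of_covRoot` of `N19InEdgesAtRecord.ne3Liaison_of_covRoot` (lens row LC-1; LIFT of the lens seat's kernel-checked sketch)

Cell `pub-ymgap`, HUMAN RULING D-0062 (Track A).  FAN-OUT row LC-1 of the lens «decomp» v2 (`run/shared/lean/pub/pub-ymgap/ym-lens-BalabanUVNodes-decomp/
LENS-decomp.md` 9be38b53dab42451 §v2.5; recorded by dag-lead DEDUP-192), typed by seat `pub-ymgap-dag-n19-e` (g3) on dag-lead's word.  AUTHORSHIP: §A–§B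
below are the lens seat's `YMLens.DecompNE7v2` §A–§B (sketch `LensDecompNE7v2.sketch.lean` 5e20122e717db256, farm rc 0 ∕ 0 sorry; planner-ym-lens-
BalabanUVNodes-decomp-g2) LIFTED VERBATIM into the Theorems namespace — statements and proofs token for token, namespace and this header new.  Route
`Summits/QuantumFields/YangMills/Theses/BalabanUVNodes.lean` rev 15, cluster item K3′ «SpineGivenEndpointR12» (stmt-QuantumFields-19908; lineage K3
stmt-QuantumFields-19676); filed `--supports` that item `--as helper`.  COUNT-NEUTRAL: elementary real arithmetic + one liaison composition BY NAME; NOT a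
discharge claim; N16 ∕ N07 ∕ NE3 ∕ NE7 NOT proved.

THE POINT (lens v2, numbers not adjectives).  Print's analyticity chart for the scale-`j` E-terms is the SINGLE-SCALE space `U^c_j(X, α_{0,j}, α_{1,j})`
([Balaban1987RG1] (1.11)–(1.16), (1.13) p. 262; [Balaban1988Convergent] (2.27)(ii)+(2.28) p. 259 names it — the layered space (2.34)–(2.39) p. 261 is the
B-terms' (2.41)(ii)), with `U′ = exp iξA′`, `|A′|, |∇^ξ_U A′| < α_{1,j}`, `ξ = L^{−j}`: per bare bond the tube has radius `L^{−j}α_{1,j}` in the value and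
`L^{−2j}α_{1,j}` in the covariant difference.  N16's covariant root (`NE3.CovariantRoot.closeness_of_ne3EnergyRateWCov`) gives the two-run discrepancy
direction `Z` at level `k` in PLAIN bond units: (P) `‖Z‖ ≤ 8l₁²γ·θ^{8k}`, (Gᶜ) `‖Ad(…)Z(x+e_μ) − Z(x)‖ ≤ 4l₁√(2γΛ₂′)·θ^{13k}`, `θ⁶ = L⁻¹`.  In the
η-NORMALISED C¹ size `‖Z‖_{C¹,k} := max(L^k·sup‖Z‖, L^{2k}·sup‖Δ_cov Z‖)` (η = L^{−k}): the tube radius for EVERY scale `j ≤ k` is `≥ α_{1,j}`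
(`chartRadius_ge`: scale-free margin, layer factor 1, NO modulus `Λ`); `L^k·θ^{8k} = θ^{2k}` and `(L^k)²·θ^{13k} = θ^k` (`value_weight_eq`,
`grad_weight_eq`): `‖Z‖_{C¹,k} ≤ (8l₁²γ + 4l₁√(2γΛ₂′))·θ^k`, i.e. NE3's liaison rate for NE7's argument bracket is `θ = L^{−1∕6}` per step; (P) alone does
NOT close in this gauge (`grad_weight_value_exponent`: (Gᶜ) is LOAD-BEARING); and under the convention of record `N19InEdgesAtRecord.ne3Liaison_of_covRoot`
(`hdomc`: gauge dominated by plain `sup‖Z‖`) a Lipschitz family `CU(g, j) ≥ c·L^{2j}` is forced, for which `T4TowerRateComposition.PolyLipGrowth` FAILS for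
every exponent (`not_polyLipGrowth_of_geometric`) — the located incoherence the twin repairs.
* §A THE UNIT TABLE [folklore]: `value_weight_eq` · `grad_weight_eq` · `grad_weight_value_exponent` · `inv_le_theta` · `chartRadius_ge` ·
  `not_polyLipGrowth_of_geometric`.
* §B THE η-NORMALISED C¹ LIAISON TWIN [folklore ∕ bookkeeping]: `ne3LiaisonC1_of_covRoot` = `ne3Liaison_of_covRoot` with THREE changes — (1) the
  domination convention `hdomC1` (two weighted premises: value with weight `L^{k₀+K}`, covariant gradient with weight `(L^{k₀+K})²`); (2) the rate letter
  `θ ≤ θ₃ < 1` (replacing `L⁻¹ ≤ θ₃ ∧ θ⁸ ≤ θ₃`; `L⁻¹ = θ⁶ ≤ θ` by `inv_le_theta`); (3) N16's (Gᶜ) component CONSUMED; everything else (regime, `h16`, `h3`,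
  selection, readings) token for token as in the liaison of record.  Consumers (lens rows LC-2 ∕ NODE-O-UT, not typed here): n19-c's by-name reading
  `N19RateEdgeTube` §2 with the N16 block's clause swapped to `hdomC1`; NODE 00's `U3Tower` gauge letter := the η-C¹ size.

HONEST FRAMING.  `h16` (N16's `NE3EnergyRateWCov`), `h3` (N07's `LeafH3sup`), the selection ∕ regularity of minimisers, the readings and the convention
`hdomC1` are HYPOTHESES ∕ BINDERS; NE3 ∕ NE7 are NOT PRINTED as two-run statements and NOT PROVED; nothing of Bałaban's is asserted beyond the printed chart
LOCATORS quoted for shape; N16 ∕ N19 NOT discharged; Track A count unmoved (A 5∕28).  One finite four-torus at fixed ε, rung (B)+1 — NOT infinite volume,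
NOT OS on ℝ⁴, NOT a mass gap, NOT Clay.  THEOREMS ONLY; 0 sorry; standard axioms.
-/

set_option autoImplicit false

noncomputable section

open scoped BigOperators Matrix Matrix.Norms.L2Operator
open Finset MeasureTheory NormedSpace Metric Set

namespace Summit.QuantumFields.YangMills.BalabanUVNodes.N19InEdgesC1

open Literature.MathematicalPhysics.QuantumFieldTheory.Balaban1983to89
open B7Prop1Explicit B7Prop2Explicit
open T4AveragingDeficitWall (IsSkewDir vary Ad)
open T4OutputRate (Carriers Functional)
open T4EtaRateMin (Readings ActionRate LocalRate NE3Shape)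
open T4RateLiaison (GaugeDominated)
open T4TowerRateComposition (PolyLipGrowth)
open Summit.QuantumFields.BalabanUV.T4Continuum
open AveragingDeficitPeriodicCounting (IsPeriodicDir)
open AveragingDeficitDualResidual (dualC1 dualC2)
open AveragingDeficitDerivWallProof (wallConst)
open MinimalActionSandwich (IsMinimiser minAct)
open MinimalActionRate (Regular sfClass)
open MinimalActionRefine (RegularSup gradConst gradConst_nonneg)
open NE3EnergyShapes (IsUnitarySite IsPeriodicSite)
open NE3EnergyWeightedCovShape (NE3EnergyRateWCov)
open NE3.LeafIndexSockets (LeafH3sup)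
open NE3.CovariantRoot (closeness_of_ne3EnergyRateWCov)
open Summit.QuantumFields.YangMills.BalabanUVNodes.N16 (ne3Shape_of_n16)
open NE7EtaBackgroundRefineThresholds (thresholds_four)
open Summit.QuantumFields.YangMills.BalabanUVNodes.N19InEdgesAtRecord (fit_of_fit_one)

/-! ## §A The unit table (lens pieces T-d′∕T-f made quantitative) -/

/-- VALUE component: the η-normalised weight `L^k` against N16's (P) exponent `8k` at `θ⁶ = L⁻¹`: `L^k·θ^{8k} = θ^{2k}`. [folklore] -/
theorem value_weight_eq {L θ : ℝ} (hL : 0 < L) (hθ6 : θ ^ 6 = L⁻¹) (k : ℕ) :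
    L ^ k * θ ^ (8 * k) = θ ^ (2 * k) := by
  have h1 : L * θ ^ 6 = 1 := by rw [hθ6, mul_inv_cancel₀ hL.ne']
  calc L ^ k * θ ^ (8 * k) = (L * θ ^ 6) ^ k * θ ^ (2 * k) := by ring
    _ = θ ^ (2 * k) := by rw [h1, one_pow, one_mul]

/-- GRADIENT component: the weight `(L^k)²` against N16's (Gᶜ) exponent `13k`: `(L^k)²·θ^{13k} = θ^k` — the exponent 13 = 12 + 1 pays
the gradient's normalisation exactly, leaving the rate `θ = L^{−1∕6}` per step. [folklore] -/
theorem grad_weight_eq {L θ : ℝ} (hL : 0 < L) (hθ6 : θ ^ 6 = L⁻¹) (k : ℕ) :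
    (L ^ k) ^ 2 * θ ^ (13 * k) = θ ^ k := by
  have h1 : L * θ ^ 6 = 1 := by rw [hθ6, mul_inv_cancel₀ hL.ne']
  calc (L ^ k) ^ 2 * θ ^ (13 * k) = ((L * θ ^ 6) ^ k) ^ 2 * θ ^ k := by ring
    _ = θ ^ k := by rw [h1, one_pow, one_pow, one_mul]

/-- (P) ALONE does NOT close in the C¹ gauge: the gradient weight against the value exponent is `(L^k)²·θ^{8k} = L^{2k∕3}` — i.e.
`((L^k)²·θ^{8k})³ = (L^k)²` grows; so N16's (Gᶜ) component is LOAD-BEARING for NE7. [folklore] -/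
theorem grad_weight_value_exponent {L θ : ℝ} (hL : 0 < L) (hθ6 : θ ^ 6 = L⁻¹) (k : ℕ) :
    ((L ^ k) ^ 2 * θ ^ (8 * k)) ^ 3 = (L ^ k) ^ 2 := by
  have h1 : L * θ ^ 6 = 1 := by rw [hθ6, mul_inv_cancel₀ hL.ne']
  calc ((L ^ k) ^ 2 * θ ^ (8 * k)) ^ 3 = (L ^ k) ^ 2 * ((L * θ ^ 6) ^ k) ^ 4 := by ring
    _ = (L ^ k) ^ 2 := by rw [h1, one_pow, one_pow, mul_one]

/-- `L⁻¹ = θ⁶ ≤ θ` (`0 ≤ θ`, `1 ≤ L`): the C¹ rate `θ` dominates the action half's `L⁻¹`, so ONE rate letter `θ₃ ≥ θ` serves both. [folklore] -/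
theorem inv_le_theta {L θ : ℝ} (hL : 1 ≤ L) (hθ : 0 ≤ θ) (hθ6 : θ ^ 6 = L⁻¹) : L⁻¹ ≤ θ := by
  have h6 : θ ^ 6 ≤ 1 := by rw [hθ6]; exact inv_le_one_of_one_le₀ hL
  have hθ1 : θ ≤ 1 := (pow_le_one_iff_of_nonneg hθ (by norm_num)).mp h6
  rw [← hθ6]
  exact (pow_le_pow_of_le_one hθ hθ1 (by norm_num : 1 ≤ 6)).trans_eq (pow_one θ)

/-- The chart radius in C¹-gauge units is scale-free: for `j ≤ K`, `1 ≤ L`, `0 ≤ α`, the (1.13) radii `L^{K−j}·α` (value) and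
`(L^{K−j})²·α` (gradient) are both `≥ α` — margin `c₀ = C₁`, `κ₁ = 1`, no `Λ`. [cite: Balaban1987RG1, (1.13) p.262; Balaban1988Convergent, (2.27)(ii)+(2.28) p.259] -/
theorem chartRadius_ge {L α : ℝ} (hL : 1 ≤ L) (hα : 0 ≤ α) (j K : ℕ) :
    α ≤ min (L ^ (K - j) * α) ((L ^ (K - j)) ^ 2 * α) := by
  have h1 : 1 ≤ L ^ (K - j) := one_le_pow₀ hL
  have h2 : 1 ≤ (L ^ (K - j)) ^ 2 := one_le_pow₀ h1
  exact le_min (le_mul_of_one_le_left hα h1) (le_mul_of_one_le_left hα h2)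

/-- **THE PLAIN-GAUGE ROAD IS DEAD** (typed obstruction): a Lipschitz family with `CU(g_K, K) ≥ c·Λ^K` (`c > 0`, `Λ > 1` — e.g. the
`L^{2j}`-growth forced by a gauge dominated by plain `sup‖Z‖`) satisfies `PolyLipGrowth CU gA P q` for NO `P`, `q`. [folklore] -/
theorem not_polyLipGrowth_of_geometric {CU : (ℕ → ℝ) → ℕ → ℝ} {gA : ℕ → ℕ → ℝ} {c Λ : ℝ} (hc : 0 < c) (hΛ : 1 < Λ)
    (hCU : ∀ K, c * Λ ^ K ≤ CU (gA K) K) (P : ℝ) (q : ℕ) : ¬ PolyLipGrowth CU gA P q := by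
  intro h
  have hP : ∀ K, c * Λ ^ K ≤ P := fun K => (hCU K).trans (by simpa using (h K K le_rfl).2)
  obtain ⟨K, hK⟩ := pow_unbounded_of_one_lt (P / c) hΛ
  have hK' : P < c * Λ ^ K := (div_lt_iff₀' hc).mp hK
  exact absurd (hP K) (not_le.mpr hK')

/-! ## §B The η-normalised C¹ liaison twin of `N19InEdgesAtRecord.ne3Liaison_of_covRoot` -/

section N16

variable {n : Type*} [Fintype n] [DecidableEq n] [Nonempty n]

/-- **N16 BY NAME ⟶ `NE3Shape ∧ GaugeDominated` UNDER THE η-NORMALISED C¹ DOMINATION CONVENTION** (typed candidate for the N16∕N19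
liaison re-cut; `N19InEdgesAtRecord.ne3Liaison_of_covRoot` with THREE changes).  (1) The convention `hdomC1`: at run index `K`, admissible
`v` and every presentation `gaugeAct u (sel (k₀+K) (rd v)) = vary (rescale L (bavg L (sel (k₀+K+1) (rd v)))) Z 1`, the gauge of record is
dominated by `M` as soon as BOTH `L^{k₀+K}·‖Z x κ‖ ≤ M` (value, weight `η⁻¹`) AND `(L^{k₀+K})²·‖Ad(…)(Z(x+e_μ) κ) − Z x κ‖ ≤ M` (covariant
gradient, weight `η⁻²`) — the size in which the (I.1.13) tube has radius `≥ α_{1,j}` for every scale `j ≤ k₀+K` (`chartRadius_ge`).  (2) The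
rate letter: `θ ≤ θ₃ < 1` (for `θ⁸ ≤ θ₃`, `L⁻¹ ≤ θ₃`; `L⁻¹ = θ⁶ ≤ θ` by `inv_le_theta`).  (3) The (Gᶜ) component of
`closeness_of_ne3EnergyRateWCov` is CONSUMED (`value_weight_eq`, `grad_weight_eq`), profile constant `G = 8l₁²γ₃ + 4l₁√(2γ₃Λ₂′)`.
Everything else — regime, `h16`, `h3`, selection, readings — token for token as in the liaison of record.  NE3 ∕ N16 ∕ N07 NOT proved. [folklore] -/
theorem ne3LiaisonC1_of_covRoot {L Nper : ℕ} (hL : 2 ≤ L) (hN : 1 ≤ Nper) {ε ε₁ b c t C Λ₁ Λ₂' : ℝ}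
    (hb : 0 ≤ b) (hc : 0 ≤ c) (hbt : b ≤ t) (hct : c ≤ t) (hC : 0 ≤ C)
    (hsmall : (2 : ℝ) ^ 91 * (L : ℝ) ^ 17 * t ≤ 1) (hεt : (2 : ℝ) ^ 76 * (L : ℝ) ^ 12 * t ≤ ε)
    (hε1 : 16 * C0 4 * ε ≤ 3) (hε2 : 1024 * (4 + 1) * (4 + 4) * (L : ℝ) ^ 2 * ε ≤ 1)
    (hε₁ : ε₁ ≤ 1 / 4) (hε₁b : ε₁ ≤ b) (hε₁c : 4 * ε₁ ≤ c)
    {dom : Set (Site 4 → Fin 4 → (Matrix n n ℂ)ˣ)} (hdom : dom ⊆ sfClass 4 L Nper ε₁ 0)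
    (h16 : NE3EnergyRateWCov 4 (sfClass 4 L Nper ε) L Nper b (gradConst 4 c) C Λ₁ Λ₂' dom)
    (h3 : LeafH3sup 4 L Nper ε b c dom)
    (sel : ℕ → (Site 4 → Fin 4 → (Matrix n n ℂ)ˣ) → (Site 4 → Fin 4 → (Matrix n n ℂ)ˣ))
    (hsel : ∀ V ∈ dom, ∀ k : ℕ, IsMinimiser 4 (sfClass 4 L Nper ε) L Nper k V (sel k V))
    (hreg : ∀ V ∈ dom, ∀ k : ℕ, RegularSup 4 L Nper b c k (sel k V))
    {θ γ₃ l₁ θ₃ : ℝ} (hθ : 0 < θ) (hθ6 : θ ^ 6 = ((L : ℝ))⁻¹) (hΛ₂' : 0 < Λ₂') (hγ₃ : 0 < γ₃)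
    (hγ3 : C * (wallConst 4 L * (Nper : ℝ) ^ 2 * (Real.sqrt (gradConst 4 c) * dualC2 4 L + 2 * b ^ 2 * dualC1 4 L)) ≤ γ₃ ^ 3)
    (hl₁ : 0 < l₁) (hΛl₁ : Λ₁ ≤ l₁ ^ 3) (hfit : γ₃ * θ ^ 2 ≤ l₁ * Nper)
    (hθ₃θ : θ ≤ θ₃) (hθ₃1 : θ₃ < 1)
    {ι' X' : Type} (Rd : Readings ι' X') (rd : ι' → (Site 4 → Fin 4 → (Matrix n n ℂ)ˣ)) (hrd : ∀ v ∈ Rd.dom, rd v ∈ dom)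
    (hact : ∀ k, ∀ v ∈ Rd.dom, Rd.act k v = minAct 4 (sfClass 4 L Nper ε) L Nper k (rd v)) (hvol : (Nper : ℝ) ^ 4 ≤ Rd.vol)
    {Car : Carriers} (uA : ℕ → ι' → Car.BgA) (uB : ℕ → ι' → Car.BgB) {k₀ : ℕ} (hk₀ : 1 ≤ k₀)
    (hdomC1 : ∀ K : ℕ, ∀ v ∈ Rd.dom, ∀ (u : Site 4 → (Matrix n n ℂ)ˣ) (Z : Site 4 → Fin 4 → Matrix n n ℂ) (M : ℝ),
      IsUnitarySite u → IsPeriodicSite u ((Nper * L ^ (k₀ + K) : ℕ) : ℤ) → IsSkewDir Z → IsPeriodicDir Z ((Nper * L ^ (k₀ + K) : ℕ) : ℤ) →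
      gaugeAct u (sel (k₀ + K) (rd v)) = vary (rescale L (bavg L (sel (k₀ + K + 1) (rd v)))) Z 1 →
      (∀ (x : Site 4) (κ : Fin 4), (L : ℝ) ^ (k₀ + K) * ‖Z x κ‖ ≤ M) →
      (∀ (x : Site 4) (μ κ : Fin 4), ((L : ℝ) ^ (k₀ + K)) ^ 2 *
          ‖Ad (rescale L (bavg L (sel (k₀ + K + 1) (rd v))) (x + e κ) μ) (Z (x + e μ) κ) - Z x κ‖ ≤ M) →
      Car.gauge (uA K v) (Car.transport (uB K v)) ≤ M) :
    ∃ (C₃ : ℝ) (loc : ℕ → ι' → Unit → ℝ), 0 ≤ C₃ ∧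
      NE3Shape (⟨Rd.dom, Rd.act, loc, Rd.vol, Rd.vol_nonneg⟩ : Readings ι' Unit) C₃ θ₃ ∧
      GaugeDominated (⟨Rd.dom, Rd.act, loc, Rd.vol, Rd.vol_nonneg⟩ : Readings ι' Unit) uA uB := by
  classical
  -- letters
  have hL1 : 1 ≤ L := le_trans (by norm_num) hL
  have hL0 : (0 : ℝ) < L := by exact_mod_cast (show 0 < L by omega)
  have hL1r : (1 : ℝ) ≤ L := by exact_mod_cast hL1
  have hLinv0 : 0 ≤ ((L : ℝ))⁻¹ := inv_nonneg.mpr hL0.le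
  have h6 : θ ^ 6 ≤ 1 := by rw [hθ6]; exact inv_le_one_of_one_le₀ hL1r
  have hθ1 : θ ≤ 1 := (pow_le_one_iff_of_nonneg hθ.le (by norm_num)).mp h6
  have hθ₃L : ((L : ℝ))⁻¹ ≤ θ₃ := (inv_le_theta hL1r hθ.le hθ6).trans hθ₃θ
  have hθ₃0 : 0 ≤ θ₃ := hLinv0.trans hθ₃L
  have hθθ₃K : ∀ K : ℕ, θ ^ (k₀ + K) ≤ θ₃ ^ K := fun K =>
    calc θ ^ (k₀ + K) ≤ θ ^ K := pow_le_pow_of_le_one hθ.le hθ1 (Nat.le_add_left K k₀)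
      _ ≤ θ₃ ^ K := pow_le_pow_left₀ hθ.le hθ₃θ K
  set G : ℝ := 8 * l₁ ^ 2 * γ₃ + 4 * l₁ * Real.sqrt (2 * γ₃ * Λ₂') with hGdef
  have hG1 : 0 ≤ 8 * l₁ ^ 2 * γ₃ := by positivity
  have hG2 : 0 ≤ 4 * l₁ * Real.sqrt (2 * γ₃ * Λ₂') := by positivity
  have hG0 : 0 ≤ G := add_nonneg hG1 hG2
  -- the k-free averaging condition on `b` from threshold (ii): `52428800·L²·t ≤ 1`
  have ht0 : 0 ≤ t := hb.trans hbt
  obtain ⟨-, hT2, -⟩ := thresholds_four hL1 ht0 hsmall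
  have hbs : 512 * (4 + 1) * (4 + 4) * (L : ℝ) ^ 2 * b ≤ 1 := by
    have e : (2 : ℝ) ^ 15 * (((4 : ℕ) : ℝ) + 1) ^ 2 * (((4 : ℕ) : ℝ) + 4) ^ 2 * (L : ℝ) ^ 2 * t = 52428800 * ((L : ℝ) ^ 2 * t) := by
      push_cast; ring
    have h2 : 52428800 * ((L : ℝ) ^ 2 * t) ≤ 1 := by rw [← e]; exact hT2
    have hL2 : (0 : ℝ) ≤ (L : ℝ) ^ 2 := by positivity
    have h3' : (L : ℝ) ^ 2 * b ≤ (L : ℝ) ^ 2 * t := mul_le_mul_of_nonneg_left hbt hL2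
    have h4 : 0 ≤ (L : ℝ) ^ 2 * b := mul_nonneg hL2 hb
    nlinarith
  -- ACTION half of NE3 from N16's record decl and N07's interface, at the record's selection (`ne3Shape_of_n16` (b))
  obtain ⟨-, hall⟩ := ne3Shape_of_n16 hL hN hb hc hbt hct hC hsmall hεt hε1 hε2 hε₁ hε₁b hε₁c hdom h16 h3
  obtain ⟨C', hC'0, hsh⟩ := hall sel (fun V hV k => hsel V hV k) (fun V hV k => hreg V hV k)
  -- the geometric gauge profile in the C¹ currency
  refine ⟨max C' G, fun K _ _ => ∑ i ∈ range K, G * θ₃ ^ i, hC'0.trans (le_max_left _ _), ⟨hθ₃0, hθ₃1, ?_, ?_⟩, ?_⟩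
  · -- action rate of the re-localised family: `|A_{k+1} − A_k| ≤ C′ L^{−k} Nper⁴ ≤ max C′ G · θ₃^k · Rd.vol`
    intro k v hv
    have hA : |minAct 4 (sfClass 4 L Nper ε) L Nper (k + 1) (rd v) - minAct 4 (sfClass 4 L Nper ε) L Nper k (rd v)|
        ≤ C' * ((L : ℝ))⁻¹ ^ k * (Nper : ℝ) ^ 4 := hsh.action k (rd v) (hrd v hv)
    show |Rd.act (k + 1) v - Rd.act k v| ≤ max C' G * θ₃ ^ k * Rd.vol
    rw [hact (k + 1) v hv, hact k v hv]
    refine hA.trans (mul_le_mul (mul_le_mul (le_max_left _ _) (pow_le_pow_left₀ hLinv0 hθ₃L k) (pow_nonneg hLinv0 k)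
      (hC'0.trans (le_max_left _ _))) hvol (by positivity) ?_)
    exact mul_nonneg (hC'0.trans (le_max_left _ _)) (pow_nonneg hθ₃0 k)
  · -- pointwise rate of the profile: increments `G·θ₃^k ≤ max C′ G · θ₃^k`
    intro k v _ x
    show |(∑ i ∈ range (k + 1), G * θ₃ ^ i) - ∑ i ∈ range k, G * θ₃ ^ i| ≤ max C' G * θ₃ ^ k
    rw [Finset.sum_range_succ, add_sub_cancel_left, abs_of_nonneg (mul_nonneg hG0 (pow_nonneg hθ₃0 k))]
    exact mul_le_mul_of_nonneg_right (le_max_right _ _) (pow_nonneg hθ₃0 k)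
  · -- the gauge liaison in the C¹ currency: closeness at level `k₀ + K ≥ 1` with (P) AND (Gᶜ), the unit table, then `hdomC1`
    intro K v hv M hM
    have hMge : G * θ₃ ^ K ≤ M := by
      have h := hM ()
      change |(∑ i ∈ range (K + 1), G * θ₃ ^ i) - ∑ i ∈ range K, G * θ₃ ^ i| ≤ M at h
      rwa [Finset.sum_range_succ, add_sub_cancel_left, abs_of_nonneg (mul_nonneg hG0 (pow_nonneg hθ₃0 K))] at h
    have hk : 1 ≤ k₀ + K := le_trans hk₀ (Nat.le_add_right k₀ K)
    have hfit' : γ₃ * (θ ^ (k₀ + K)) ^ 2 ≤ l₁ * Nper := fit_of_fit_one hγ₃.le hθ.le hθ1 hfit hk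
    have hregB : Regular 4 L Nper b (gradConst 4 c) (k₀ + K + 1) (sel (k₀ + K + 1) (rd v)) :=
      (hreg (rd v) (hrd v hv) (k₀ + K + 1)).regular
    obtain ⟨u, Z, hu, hup, hZs, hZp, hrepr, hZ, hZg, -, -⟩ :=
      closeness_of_ne3EnergyRateWCov hL hN hθ hθ6 hb hbs (gradConst_nonneg (d := 4) c) hC hΛ₂' h16 hγ₃ hγ3 hl₁ hΛl₁ hk hfit'
        (hrd v hv) (hsel (rd v) (hrd v hv) (k₀ + K)) (hsel (rd v) (hrd v hv) (k₀ + K + 1)) hregB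
    have hunit1 : (L : ℝ) ^ (k₀ + K) * θ ^ (8 * (k₀ + K)) = θ ^ (2 * (k₀ + K)) := value_weight_eq hL0 hθ6 _
    have hunit2 : ((L : ℝ) ^ (k₀ + K)) ^ 2 * θ ^ (13 * (k₀ + K)) = θ ^ (k₀ + K) := grad_weight_eq hL0 hθ6 _
    have h2k : θ ^ (2 * (k₀ + K)) ≤ θ₃ ^ K :=
      (pow_le_pow_of_le_one hθ.le hθ1 (by omega : k₀ + K ≤ 2 * (k₀ + K))).trans (hθθ₃K K)
    have hval : ∀ (x : Site 4) (κ : Fin 4), (L : ℝ) ^ (k₀ + K) * ‖Z x κ‖ ≤ M := fun x κ =>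
      calc (L : ℝ) ^ (k₀ + K) * ‖Z x κ‖ ≤ (L : ℝ) ^ (k₀ + K) * (8 * l₁ ^ 2 * γ₃ * θ ^ (8 * (k₀ + K))) :=
            mul_le_mul_of_nonneg_left (hZ x κ) (pow_nonneg hL0.le _)
        _ = 8 * l₁ ^ 2 * γ₃ * θ ^ (2 * (k₀ + K)) := by rw [← hunit1]; ring
        _ ≤ 8 * l₁ ^ 2 * γ₃ * θ₃ ^ K := mul_le_mul_of_nonneg_left h2k hG1
        _ ≤ G * θ₃ ^ K := mul_le_mul_of_nonneg_right (le_add_of_nonneg_right hG2) (pow_nonneg hθ₃0 K)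
        _ ≤ M := hMge
    have hgrad : ∀ (x : Site 4) (μ κ : Fin 4), ((L : ℝ) ^ (k₀ + K)) ^ 2 *
        ‖Ad (rescale L (bavg L (sel (k₀ + K + 1) (rd v))) (x + e κ) μ) (Z (x + e μ) κ) - Z x κ‖ ≤ M := fun x μ κ =>
      calc ((L : ℝ) ^ (k₀ + K)) ^ 2 * ‖Ad (rescale L (bavg L (sel (k₀ + K + 1) (rd v))) (x + e κ) μ) (Z (x + e μ) κ) - Z x κ‖
            ≤ ((L : ℝ) ^ (k₀ + K)) ^ 2 * (4 * l₁ * Real.sqrt (2 * γ₃ * Λ₂') * θ ^ (13 * (k₀ + K))) :=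
            mul_le_mul_of_nonneg_left (hZg x μ κ) (by positivity)
        _ = 4 * l₁ * Real.sqrt (2 * γ₃ * Λ₂') * θ ^ (k₀ + K) := by rw [← hunit2]; ring
        _ ≤ 4 * l₁ * Real.sqrt (2 * γ₃ * Λ₂') * θ₃ ^ K := mul_le_mul_of_nonneg_left (hθθ₃K K) hG2
        _ ≤ G * θ₃ ^ K := mul_le_mul_of_nonneg_right (le_add_of_nonneg_left hG1) (pow_nonneg hθ₃0 K)
        _ ≤ M := hMge
    exact hdomC1 K v hv u Z M hu hup hZs hZp hrepr hval hgrad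

end N16

end Summit.QuantumFields.YangMills.BalabanUVNodes.N19InEdgesC1

end
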